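import Summits.HodgeConjecture.FermatCycles.ConditionQFourfoldSearch
import Summits.HodgeConjecture.FermatCycles.ConditionQFourfoldSixtySixTable
import Summits.HodgeConjecture.FermatCycles.ConditionQFourfoldSixtySixA
import Summits.HodgeConjecture.FermatCycles.ConditionQFourfoldSixtySixB
import HarnessLib

/-!
# Shioda's stable-generation condition `(Q⁴ₘ)` at `m = 66` and the failure of `(P⁴ₘ)` — kernel certificate (part C of 3)

HONEST FRAMING: explicit algebraic cycles for specific Hodge classes on Fermat/Delsarte varieties;
residual open instances listed; no claim on general Hodge.

Topic path `Summits/HodgeConjecture/FermatCycles/` of cell `pub-hfermat` (new work, not literature: a computer determination of the cell —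
`pub-hfermat-enum/P4-TABLE.md` §(Q⁴ₘ), two implementations — certified by the Lean kernel). Framework: `ConditionQFourfold.lean`
(certificate Booleans, searches `checkQU`/`checkQN`) and `ConditionQFourfoldSearch.lean` (`conditionQ_four_of_normalized`).

THE STATEMENT. Shioda, Math. Ann. 245 (1979) §4 p. 183: `(Qⁿₘ)` — every element of `Mₘ(y)`, `3 ≤ y ≤ n/2 + 1`, is `ξ₁ − ξ₂` with
`ξ₁, ξ₂ ∈ M'ₘ = ⟨Mₘ(1), Mₘ(2), Mₘ(3)^sd⟩` (pairs, Hodge classes of the Fermat surface, semi-decomposable sextuples); by his Claim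
(p. 183, Lemmas 2–3) `(Qⁿₘ)` may replace `(Pⁿₘ)` in Theorem III (`⇒` the Hodge conjecture for `Xⁿₘ`); p. 184: "we do not know any
value of `m` which satisfies `(Qₘ)` but not `(Pₘ)`". Tree: `Literature.AlgebraicGeometry.Shioda1979.ConditionQ m n`, `MPrime`,
`forall_of_conditionQ` (the Claim's arithmetic spine), `ConditionP` (Math. Ann. form of `(P)`), `FermatCharacter.ShiodaConditionUpTo`
(Proc. Japan Acad. form, with the semi-decomposable alternative).

WHAT IS PROVED HERE (level `m = 66`, part C).
* part C of 3: the kernel searches `checkQN 66 T 11 7`, `checkQN 66 T 18 48` (89115 tuples);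
* **`conditionQ_sixtySix_four : Shioda1979.ConditionQ 66 4`** — `(Q⁴ₘ)` holds at `m = 66`: every Hodge sextuple over `ℤ/66` (every Hodge character of the
  Fermat fourfold `X⁴ₘ`, `m = 66`, up to permutation) is `ξ₁ − ξ₂`, `ξᵢ ∈ M'ₘ`;
* `forall_of_closed_cancellative_sixtySix`: by Shioda's Claim (`forall_of_conditionQ`), every Shioda-closed, Lemma-3-cancellative family of
  multisets over `ℤ/66` contains every non-empty Hodge multiset of cardinality `≤ 6`;
* the NEGATIVE side on the sextuple `s = (1, 5, 36, 38, 54, 64)`: Hodge (`isHodgeMultiset_fail_sixtySix`), no proper non-empty sub-multiset with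
  zero sum (`sum_ne_zero_of_mem_powerset_fail_sixtySix`: hence not decomposable, not semi-decomposable), not quasi-decomposable (`fail_sixtySix_key`,
  `66 · 2⁸` kernel cases) ⇒ **`not_shiodaConditionUpTo_sixtySix_four : ¬ ShiodaConditionUpTo 66 4`** (the Proc. Japan Acad. form of `(P⁴ₘ)`
  fails), `not_conditionP_sixtySix_four : ¬ Shioda1979.ConditionP 66 4` (the Math. Ann. form fails), and the conjunction
  `conditionQ_not_conditionP_sixtySix : ConditionQ 66 4 ∧ ¬ ConditionP 66 4` — at `m = 66`, for fourfolds, Shioda's weakening `(Q)` of `(P)` is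
  NECESSARY as well as sufficient.

NUMBERS (this seat's search `code/lit/q4/q4norm.py` = implementation 2; implementation 1 = ENUM `code/enum/q4table.py`,
`data/shioda_Q4_m3-100.json`): case U visits 78778 sorted tuples and case N 178841; 4636 of them are Hodge sextuples; all but 71 carry a
`(P)`-witness (case N pair 97, case N quasi 62, case N pair 3266, case N quasi 150, case N semi 32, case U pair 865, case U quasi 86, case U semi 7); the other 71 — `(1, 5, 36, 38, 54, 64)` (case U); `(1, 5, 45, 46, 50, 51)` (case U); `(1, 6, 10, 54, 63, 64)` (case U); `(1, 8, 22, 50, 55, 62)` (case U); `(1, 8, 23, 52, 54, 60)` (case U); `(1, 9, 10, 53, 62, 63)` (case U); `(1, 9, 23, 51, 54, 60)` (case U); `(1, 9, 34, 46, 48, 60)` (case U); `(1, 10, 18, 51, 54, 64)` (case U); `(1, 10, 24, 46, 54, 63)` (case U); `(1, 10, 27, 36, 60, 64)` (case U); `(1, 10, 36, 42, 45, 64)` (case U); `(1, 10, 36, 45, 46, 60)` (case U); `(1, 12, 34, 45, 46, 60)` (case U); `(1, 18, 23, 37, 59, 60)` (case U); `(1, 20, 23, 36, 54, 64)` (case U);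 `(1, 22, 25, 31, 55, 64)` (case U); `(1, 22, 25, 37, 55, 58)` (case U); `(1, 22, 34, 37, 49, 55)` (case U); `(1, 23, 24, 34, 56, 60)` (case U); `(1, 23, 24, 36, 54, 60)` (case U); `(1, 23, 25, 47, 48, 54)` (case U); `(1, 24, 26, 34, 53, 60)` (case U); `(1, 24, 30, 34, 46, 63)` (case U); `(1, 24, 34, 39, 46, 54)` (case U); `(1, 25, 31, 37, 49, 55)` (case U); `(2, 3, 12, 56, 60, 65)` (case N); `(2, 6, 30, 39, 56, 65)` (case N); `(2, 8, 32, 44, 50, 62)` (case N); `(2, 9, 30, 46, 48, 63)` (case N); `(2, 12, 15, 48, 56, 65)` (case N); `(2, 21, 24, 30, 56, 65)` (case N); `(3, 8, 21, 52, 54, 60)` (case N); `(3, 12, 20, 42, 56, 65)` (case N); `(3, 12, 28, 34, 60, 61)` (case N); `(3, 18, 20, 36, 57, 64)` (case N); `(3, 20, 32, 36, 42, 65)` (case N); `(3, 28, 34, 36, 48, 49)` (case N); `(4, 11, 16, 44, 58, 65)` (case N); `(4, 16, 22, 34, 58, 64)` (case N); `(4, 26, 27, 30, 51, 60)` (case N);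 `(6, 12, 14, 45, 58, 63)` (case N); `(6, 15, 36, 39, 40, 62)` (case N); `(6, 18, 20, 32, 57, 65)` (case N); `(6, 20, 21, 30, 56, 65)` (case N); `(6, 20, 21, 32, 54, 65)` (case N); `(6, 28, 30, 34, 39, 61)` (case N); `(8, 15, 26, 42, 48, 59)` (case N); `(8, 18, 26, 30, 57, 59)` (case N); `(8, 21, 26, 30, 54, 59)` (case N); `(9, 10, 16, 42, 60, 61)` (case N); `(9, 16, 38, 39, 42, 54)` (case N); `(10, 11, 28, 44, 46, 59)` (case N); `(10, 11, 28, 44, 52, 53)` (case N); `(10, 11, 40, 44, 46, 47)` (case N); `(10, 15, 16, 36, 60, 61)` (case N); `(10, 16, 18, 39, 54, 61)` (case N); `(10, 16, 36, 42, 45, 49)` (case N); `(10, 18, 32, 42, 45, 51)` (case N); `(10, 22, 28, 40, 46, 52)` (case N); `(10, 27, 28, 36, 48, 49)` (case N); `(12, 15, 16, 34, 60, 61)` (case N); `(12, 15, 28, 34, 48, 61)` (case N); `(12, 20, 27, 32, 42, 65)` (case N); `(12, 24, 27, 28, 50, 57)` (case N); `(12, 27, 28, 34, 48, 49)` (case N);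 `(14, 20, 22, 26, 55, 61)` (case N); `(14, 20, 26, 38, 44, 56)` (case N); `(15, 21, 24, 34, 48, 56)` (case N); `(16, 18, 30, 34, 39, 61)` (case N); `(21, 24, 28, 30, 34, 61)` (case N) — carry the table
certificate(s) written out in the statements below (generators checked by `genB`, the identity `s + ΣX = ΣY` by `decide`, all inside the kernel search).

PRINT STATUS (lit seat, 2026-08-20). `66 = 2·3·11`: NO refereed theorem gives the Hodge conjecture for `X⁴₆₆` (not prime / `≤ 21` / prime power / `2pᵉ` / `{2,3,5,7}`-smooth; `3 | 66` puts it outside da Silva's Prop. 3.1; even, outside the odd-degree preprint arXiv:2608.18134). In the tree the sibling cell pub-hodgefermat reaches `66` by LEVEL RAISING from `33`; the cell's table settles `(66, 4)` by Lemma 3 cancellation (E3, two implementations). This file gives an INDEPENDENT route inside Shioda's own 1979 framework: `(Q⁴₆₆)` as a kernel theorem, so HC(X⁴₆₆) follows from the printed Claim alone.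

References: [Shioda1979HodgeFermat] T. Shioda, Math. Ann. 245 (1979) 175–184, §3 p. 180 (`(Pⁿₘ)`), §4 pp. 183–184 (`M'ₘ`, `(Qⁿₘ)`, Claim,
the question); [Shioda1979PJA] T. Shioda, Proc. Japan Acad. 55A (1979) §1 (Definition (i)–(iii), `(Pⁿₘ)'`); [daSilva2021HodgeFermat]
G. da Silva Jr., Experimental Results 2 (2021) e22, Def. 2.4, Question 1; [Aoki2000FermatTypeRemarks] N. Aoki, Comment. Math. Univ.
St. Pauli 49 (2000), Thm 0.1. Cell: `pub-hfermat-enum/P4-TABLE.md`, `data/shioda_Q4_m3-100.json`, `code/lit/q4/` (this seat).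
-/

namespace Summit.HodgeConjecture.FermatCycles.ConditionQFourfold

open Multiset
open Literature.AlgebraicGeometry.HodgeTheory Literature.AlgebraicGeometry.HodgeTheory.FermatCharacter
open Literature.AlgebraicGeometry.Shioda1982 Literature.AlgebraicGeometry.Shioda1979
open Summit.HodgeConjecture.FermatCycles.ShiodaConditionFourfold

/-! ### Level `66` — part C -/

/-! The certificate table at level `66` is the definition `table66` of `ConditionQFourfoldSixtySixTable.lean` (71 entries `(key, X, Y)`,
`s + ΣX = ΣY`; found by `code/lit/q4/q4norm.py`, every entry checked by the kernel inside the searches). -/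

set_option maxHeartbeats 0 in
/-- The `(Q)`-search at level `66`, case N, first free representative in `[11, 18)` (66103 tuples). Kernel.
[cite: Shioda1979HodgeFermat, §4 condition (Qⁿₘ), p. 183] -/
theorem checkQN_66_11 :
    checkQN 66
      table66
      11 7 = true := by
  decide +kernel

set_option maxHeartbeats 0 in
/-- The `(Q)`-search at level `66`, case N, first free representative in `[18, 66)` (23012 tuples). Kernel.
[cite: Shioda1979HodgeFermat, §4 condition (Qⁿₘ), p. 183] -/
theorem checkQN_66_18 :
    checkQN 66
      table66
      18 48 = true := by
  decide +kernel

/-- **`(Q⁴ₘ)` holds at `m = 66`**: every Hodge sextuple over `ℤ/66` is `ξ₁ − ξ₂` with `ξ₁, ξ₂ ∈ M'ₘ` (stably generated by pairs, Hodge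
`4`-sets and semi-decomposable sextuples). Kernel certificate of the cell's entry `66 ∈ Q4_true_P4_false` (P4-TABLE §(Q⁴ₘ)).
[cite: Shioda1979HodgeFermat, §4 condition (Qⁿₘ), p. 183] -/
theorem conditionQ_sixtySix_four : ConditionQ 66 4 :=
  haveI : Fact (1 < 66) := ⟨by norm_num⟩
  conditionQ_four_of_normalized 66
    table66
    [(1, 24), (25, 41)]
    (by
      intro b h0 hN
      rcases Nat.lt_or_ge b 25 with h0 | h0
      · exact ⟨(1, 24), by simp, by omega, by omega⟩
      exact ⟨(25, 41), by simp, by omega, by omega⟩)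
    (by
      intro p hp
      simp only [List.mem_cons, List.not_mem_nil, or_false] at hp
      rcases hp with rfl | rfl
      · exact checkQU_66_1
      · exact checkQU_66_25)
    [(1, 3), (4, 4), (8, 3), (11, 7), (18, 48)]
    (by
      intro a h0 hN
      rcases Nat.lt_or_ge a 4 with h0 | h0
      · exact ⟨(1, 3), by simp, by omega, by omega⟩
      rcases Nat.lt_or_ge a 8 with h1 | h1
      · exact ⟨(4, 4), by simp, by omega, by omega⟩
      rcases Nat.lt_or_ge a 11 with h2 | h2
      · exact ⟨(8, 3), by simp, by omega, by omega⟩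
      rcases Nat.lt_or_ge a 18 with h3 | h3
      · exact ⟨(11, 7), by simp, by omega, by omega⟩
      exact ⟨(18, 48), by simp, by omega, by omega⟩)
    (by
      intro p hp
      simp only [List.mem_cons, List.not_mem_nil, or_false] at hp
      rcases hp with rfl | rfl | rfl | rfl | rfl
      · exact checkQN_66_1
      · exact checkQN_66_4
      · exact checkQN_66_8
      · exact checkQN_66_11
      · exact checkQN_66_18)

/-- **Shioda's Claim at `m = 66`**: every family of multisets over `ℤ/66` closed under the inductive structure of Fermat varieties
(pairs, surface classes, semi / star / hash) and under Lemma 3's cancellation contains every non-empty Hodge multiset with at most `6`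
elements — the arithmetic form of "`(Q⁴ₘ)` ⇒ the Hodge conjecture for `X⁴ₘ`" at `m = 66` (geometric inputs = the hypotheses, as printed).
[cite: Shioda1979HodgeFermat, §4 Claim, Lemmas 2–3, p. 183] -/
theorem forall_of_closed_cancellative_sixtySix {C : Multiset (ZMod 66) → Prop} (hC : IsShiodaClosed C) (hL : IsCancellative C) :
    ∀ s : Multiset (ZMod 66), s ≠ 0 → IsHodgeMultiset s → card s ≤ 6 → C s :=
  forall_of_conditionQ hC hL conditionQ_sixtySix_four

/-! ### The negative side at `m = 66`: `(P⁴ₘ)` fails on `s = (1, 5, 36, 38, 54, 64)` -/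

/-- `s` is a Hodge sextuple over `ℤ/66` (a Hodge character of the Fermat fourfold of degree `66`). [cite: Shioda1979PJA, §1 eqs. (2)–(3)] -/
theorem isHodgeMultiset_fail_sixtySix : IsHodgeMultiset ({1, 5, 36, 38, 54, 64} : Multiset (ZMod 66)) :=
  isHodgeMultiset_of_hodgeUB (N := 66) (by decide +kernel)

/-- Every proper non-empty sub-multiset of `s` has non-zero sum: `s` contains no pair `{a, −a}`, no Hodge sub-multiset, no zero-sum
triple. [cite: Shioda1979PJA, §1 Definition (i), (iii)] -/
theorem sum_ne_zero_of_mem_powerset_fail_sixtySix :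
    ∀ t ∈ Multiset.powerset ({1, 5, 36, 38, 54, 64} : Multiset (ZMod 66)), t ≠ 0 → ({1, 5, 36, 38, 54, 64} : Multiset (ZMod 66)) - t ≠ 0 → t.sum ≠ 0 := by
  decide +kernel

/-- `s` is **not decomposable** (a summand would be a proper non-empty zero-sum sub-multiset). [cite: Shioda1979PJA, §1 Definition (i)] -/
theorem not_isDecomposable_fail_sixtySix : ¬ IsDecomposable ({1, 5, 36, 38, 54, 64} : Multiset (ZMod 66)) := by
  rintro ⟨t, u, ht0, hu0, ht, -, heq⟩
  have htle : t ≤ ({1, 5, 36, 38, 54, 64} : Multiset (ZMod 66)) := heq ▸ Multiset.le_add_right t u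
  have hu : ({1, 5, 36, 38, 54, 64} : Multiset (ZMod 66)) - t = u := by rw [heq, add_tsub_cancel_left]
  exact sum_ne_zero_of_mem_powerset_fail_sixtySix t (Multiset.mem_powerset.2 htle) ht0 (hu ▸ hu0) ht.1.2

/-- `s` is **not semi-decomposable** (no zero-sum triple). [cite: Shioda1979PJA, §1 Definition (iii)] -/
theorem not_isSemiDecomposable_fail_sixtySix : ¬ IsSemiDecomposable ({1, 5, 36, 38, 54, 64} : Multiset (ZMod 66)) := by
  rintro ⟨t, u, ht3, hu3, hts, -, heq⟩
  have htle : t ≤ ({1, 5, 36, 38, 54, 64} : Multiset (ZMod 66)) := heq ▸ Multiset.le_add_right t u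
  have hu : ({1, 5, 36, 38, 54, 64} : Multiset (ZMod 66)) - t = u := by rw [heq, add_tsub_cancel_left]
  have ht0 : t ≠ 0 := by rintro rfl; simp at ht3
  have hu0 : u ≠ 0 := by rintro rfl; simp at hu3
  exact sum_ne_zero_of_mem_powerset_fail_sixtySix t (Multiset.mem_powerset.2 htle) ht0 (hu ▸ hu0) hts

/-- A Hodge multiset over `ℤ/66` satisfies the finitely many conditions used by the kernel refutation below (entries non-zero, sum
zero, Shioda's norm equation at the units `1, 7, 13, 31` — a sub-family of Shioda's equations (2) that already admits no splitting, chosen by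
`code/lit/q4/minunits.py`). [cite: Shioda1979PJA, §1 eq. (2)] -/
theorem hodgeConditions_sixtySix {v : Multiset (ZMod 66)} (hv : IsHodgeMultiset v) :
    ((v).sum = 0 ∧ (∀ a ∈ v, a ≠ 0) ∧
            2 * mNormSum ((v).map fun a ↦ (1 : ZMod 66) * a) = 66 * Multiset.card (v) ∧
            2 * mNormSum ((v).map fun a ↦ (7 : ZMod 66) * a) = 66 * Multiset.card (v) ∧
            2 * mNormSum ((v).map fun a ↦ (13 : ZMod 66) * a) = 66 * Multiset.card (v) ∧
            2 * mNormSum ((v).map fun a ↦ (31 : ZMod 66) * a) = 66 * Multiset.card (v)) := by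
  have h1 := hv.2 (Units.mkOfMulEqOne 1 1 (by decide))
  have h7 := hv.2 (Units.mkOfMulEqOne 7 19 (by decide))
  have h13 := hv.2 (Units.mkOfMulEqOne 13 61 (by decide))
  have h31 := hv.2 (Units.mkOfMulEqOne 31 49 (by decide))
  simp only [Units.val_mkOfMulEqOne] at h1 h7 h13 h31
  exact ⟨hv.1.2, hv.1.1, h1, h7, h13, h31⟩

set_option maxHeartbeats 0 in
/-- The arithmetic heart of "`s` is **not quasi-decomposable**": for every `e ∈ ℤ/66` and every splitting `s + {e, −e} = t + u` into
non-empty parts different from `s`, one of `t`, `u` violates a condition of `hodgeConditions_sixtySix` (the zero-sum test comes first, so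
the kernel discards almost every splitting on one addition). Kernel, one residue `e` at a time (`66 · 2⁸` cases). [cite: daSilva2021HodgeFermat, Def. 2.4] [cite: Shioda1979PJA, §1 Definition (ii)] -/
theorem fail_sixtySix_key :
    ∀ e : ZMod 66, ∀ t ∈ Multiset.powerset (({1, 5, 36, 38, 54, 64} : Multiset (ZMod 66)) + {e, -e}),
      ¬ (((t).sum = 0 ∧ (∀ a ∈ t, a ≠ 0) ∧
            2 * mNormSum ((t).map fun a ↦ (1 : ZMod 66) * a) = 66 * Multiset.card (t) ∧
            2 * mNormSum ((t).map fun a ↦ (7 : ZMod 66) * a) = 66 * Multiset.card (t) ∧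
            2 * mNormSum ((t).map fun a ↦ (13 : ZMod 66) * a) = 66 * Multiset.card (t) ∧
            2 * mNormSum ((t).map fun a ↦ (31 : ZMod 66) * a) = 66 * Multiset.card (t)) ∧
          (((({1, 5, 36, 38, 54, 64} : Multiset (ZMod 66)) + {e, -e}) - t).sum = 0 ∧ (∀ a ∈ (({1, 5, 36, 38, 54, 64} : Multiset (ZMod 66)) + {e, -e}) - t, a ≠ 0) ∧
            2 * mNormSum (((({1, 5, 36, 38, 54, 64} : Multiset (ZMod 66)) + {e, -e}) - t).map fun a ↦ (1 : ZMod 66) * a) = 66 * Multiset.card ((({1, 5, 36, 38, 54, 64} : Multiset (ZMod 66)) + {e, -e}) - t) ∧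
            2 * mNormSum (((({1, 5, 36, 38, 54, 64} : Multiset (ZMod 66)) + {e, -e}) - t).map fun a ↦ (7 : ZMod 66) * a) = 66 * Multiset.card ((({1, 5, 36, 38, 54, 64} : Multiset (ZMod 66)) + {e, -e}) - t) ∧
            2 * mNormSum (((({1, 5, 36, 38, 54, 64} : Multiset (ZMod 66)) + {e, -e}) - t).map fun a ↦ (13 : ZMod 66) * a) = 66 * Multiset.card ((({1, 5, 36, 38, 54, 64} : Multiset (ZMod 66)) + {e, -e}) - t) ∧
            2 * mNormSum (((({1, 5, 36, 38, 54, 64} : Multiset (ZMod 66)) + {e, -e}) - t).map fun a ↦ (31 : ZMod 66) * a) = 66 * Multiset.card ((({1, 5, 36, 38, 54, 64} : Multiset (ZMod 66)) + {e, -e}) - t)) ∧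
          t ≠ 0 ∧ (({1, 5, 36, 38, 54, 64} : Multiset (ZMod 66)) + {e, -e}) - t ≠ 0 ∧ t ≠ ({1, 5, 36, 38, 54, 64} : Multiset (ZMod 66)) ∧ (({1, 5, 36, 38, 54, 64} : Multiset (ZMod 66)) + {e, -e}) - t ≠ ({1, 5, 36, 38, 54, 64} : Multiset (ZMod 66))) := by
  intro e
  obtain ⟨k, hk, rfl⟩ : ∃ k < 66, ((k : ℕ) : ZMod 66) = e :=
    ⟨e.val, e.val_lt, ZMod.natCast_zmod_val e⟩
  interval_cases k <;> decide +kernel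

/-- `s` is **not quasi-decomposable** (no `e ≠ 0` with `s + {e, −e} = ξ' + ξ''`, `ξ', ξ''` Hodge, both different from `s`).
[cite: daSilva2021HodgeFermat, Def. 2.4] [cite: Shioda1979PJA, §1 Definition (ii)] -/
theorem not_isQuasiDecomposable_fail_sixtySix : ¬ IsQuasiDecomposable ({1, 5, 36, 38, 54, 64} : Multiset (ZMod 66)) := by
  rintro ⟨e, -, t, u, ht0, hu0, ht, hu, hts, hus, heq⟩
  have htle : t ≤ ({1, 5, 36, 38, 54, 64} : Multiset (ZMod 66)) + {e, -e} := heq ▸ Multiset.le_add_right t u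
  have hu' : ({1, 5, 36, 38, 54, 64} : Multiset (ZMod 66)) + {e, -e} - t = u := by rw [heq, add_tsub_cancel_left]
  subst hu'
  exact fail_sixtySix_key e t (Multiset.mem_powerset.2 htle)
    ⟨hodgeConditions_sixtySix ht, hodgeConditions_sixtySix hu, ht0, hu0, hts, hus⟩

/-- **`(P⁴ₘ)` fails at `m = 66`** (Proc. Japan Acad. form, tree `ShiodaConditionUpTo 66 4`): the Hodge sextuple `s` is neither decomposable,
nor quasi-decomposable, nor semi-decomposable. Kernel certificate of the cell's P4-TABLE entry (two implementations + referee).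
[cite: Shioda1979PJA, §1 condition (Pⁿₘ)] -/
theorem not_shiodaConditionUpTo_sixtySix_four : ¬ ShiodaConditionUpTo 66 4 := fun h ↦ by
  rcases h _ isHodgeMultiset_fail_sixtySix (by decide) (by decide) with hd | hq | hs
  · exact not_isDecomposable_fail_sixtySix hd
  · exact not_isQuasiDecomposable_fail_sixtySix hq
  · exact not_isSemiDecomposable_fail_sixtySix hs

/-- Hence `(Pₘ)` (Proc. Japan Acad. form, all lengths) fails at `m = 66`. [cite: Shioda1979PJA, §1 conditions (Pⁿₘ), (Pₘ)] -/
theorem not_shiodaCondition_sixtySix : ¬ ShiodaCondition 66 := fun h ↦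
  not_shiodaConditionUpTo_sixtySix_four (shiodaCondition_iff_forall_upTo.1 h 4)

/-- **The Math. Ann. form of `(P⁴ₘ)` fails at `m = 66`** too: `s` is indecomposable and not quasi-decomposable.
[cite: Shioda1979HodgeFermat, §3 condition (Pⁿₘ), p. 180] -/
theorem not_conditionP_sixtySix_four : ¬ ConditionP 66 4 := fun h ↦
  not_isQuasiDecomposable_fail_sixtySix
    (h _ isHodgeMultiset_fail_sixtySix (by decide) (by decide) not_isDecomposable_fail_sixtySix)

/-- Hence the Math. Ann. condition `(Pₘ)` fails at `m = 66`. [cite: Shioda1979HodgeFermat, §3 condition (Pₘ), p. 180] -/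
theorem not_conditionPAll_sixtySix : ¬ ConditionPAll 66 := fun h ↦
  not_conditionP_sixtySix_four (conditionPAll_iff_forall.1 h 4)

/-- **Shioda's question (Math. Ann. 245, p. 184), the fourfold instance at `m = 66`**: "we do not know any value of `m` which satisfies
`(Qₘ)` but not `(Pₘ)`" — at `m = 66` the length-`3` condition `(Q⁴ₘ)` HOLDS while `(P⁴ₘ)` FAILS (in both printed forms). Whether `(Qₘ)` holds
at ALL lengths for `m = 66` is not decided here. Computer-assisted (cell `pub-hfermat`, two implementations), certified by the kernel.
[cite: Shioda1979HodgeFermat, §4, p. 184 (the question)] -/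
theorem conditionQ_not_conditionP_sixtySix : ConditionQ 66 4 ∧ ¬ ConditionP 66 4 :=
  ⟨conditionQ_sixtySix_four, not_conditionP_sixtySix_four⟩

end Summit.HodgeConjecture.FermatCycles.ConditionQFourfold
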